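import Mathlib
import HarnessLib
import HarnessLib.Audit
import Summits.SmoothPoincare4.Statement
import Literature.Topology.FourManifolds.Morse
import HarnessLib.Audit.Status.Attr

/-!
Route: EntropyLadder

DORMANT since 2026-08-23T04:10:37Z (reconciler: no traction for 5.9 d (last activity item-evidence-added at 2026-08-17T06:15:11Z); parked, not closed — `ledger route dormant route-SmoothPoincare4-EntropyLadder --off` to reactivate) — unstaffed, not closed; items shared with open routes are served there. `ledger route dormant <id> --off` reactivates.

# Route EntropyLadder — Gaussian-thin homotopy 4-spheres are presentation spheres — the λ(S¹×ℝ³)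
rung of the MCF entropy ladder plus its existence half

It suffices to show X = E ∧ G ∧ T (card entropy-ladder-lambda1-rung, which absorbed entropy-gap-r5
and superseded gaussian-entropy-mcf). Filter homotopy 4-spheres Σ by the Colding–Minicozzi entropy λ
of their smooth embeddings ι : Σ ↪ ℝ⁵ (λ(A) = sup over centres p and scales t > 0 of (4πt)⁻² ∫_A
e^(−|x−p|²/4t) dH⁴; Stone values λ(S⁴) = 1.4436 < λ(S³×ℝ) = 1.4531 < λ(S²×ℝ²) = 4/e = 1.4715 <
λ(S¹×ℝ³) = √(2π/e) = 1.5203). Rungs 1–2 are THEOREMS ([ChodoshMantoulidisSchulze2025] Cor 1.5/1.22,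
n = 4, unconditional): λ(ιΣ) ≤ λ(S²×ℝ²) ⇒ Σ ≅ S⁴. X is the next rung plus its existence half:
(T) PresentationSpheresStandard — a homotopy 4-sphere bounding a compact contractible smooth
5-manifold with a handle decomposition into handles of index ≤ 2 (= a presentation sphere ∂H⁵(P,ε),
P a balanced presentation of the trivial group, ε ∈ (ℤ/2)^r the 2-handle framings) is diffeomorphic
to S⁴;
(G) ThinSpheresBoundTwoHandlebodies — a homotopy 4-sphere smoothly embedded in ℝ⁵ with λ < λ(S¹×ℝ³)
bounds such a 5-manifold (generic mean curvature flow meets only multiplicity-one nondegenerate S⁴,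
S³×ℝ, S²×ℝ² singularities; its spacetime track is the null-cobordism, one (4−k)-handle per
S^k×ℝ^(4−k) singular point);
(E) ThinEmbeddingExists — every homotopy 4-sphere has a smooth embedding into ℝ⁵ with λ < λ(S¹×ℝ³).
Notation used in the items (all spelled out there): ent(A) := ⨆ (p : EuclideanSpace ℝ (Fin 5)) (t :
ℝ) (_ : 0 < t), (ENNReal.ofReal (t ^ 2))⁻¹ * ∫⁻ x in A, ENNReal.ofReal (Real.exp (-(‖x - p‖ ^ 2) /
(4 * t))) ∂μH[4] — the unnormalised Gaussian area in ℝ≥0∞; every threshold is written ent(A) <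
ent(Cyl₁) with Cyl₁ := {y | y 0 ^ 2 + y 1 ^ 2 = 2} = S¹(√2)×ℝ³ the self-shrinking cylinder, so the
Hausdorff-measure normalisation and (4π)⁻² cancel. Bounds₂(M) := ∃ W (compact C^∞ 5-manifold with
boundary, charted on EuclideanHalfSpace (4+1)), ContractibleSpace W ∧ (∃ f : W → ℝ, IsMorseAdapted
(𝓡∂ 5) f ∧ every critical point has morseIndex ≤ 2) ∧ ∃ φ : M → W smooth embedding with range φ =
(𝓡∂ 5).boundary W — i.e. `Literature.Topology.FourManifolds.IsHandlebodyOfIndexLE 4 2 W` unfolded +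
contractible + ∂W = M (unfolded so that the route imports only Morse.lean and its import cone
carries no unproved Literature fact). All items quantify over the bare shape of the summit statement
(M : Type, T2, second countable, charted on ℝ⁴, C^∞, M ≃ₕ 𝕊⁴), so no packaging facts are needed.
Every decl elaborated 2026-08-15 in the planner's Sketch.lean (`lean check` rc 0; imports Mathlib,
HarnessLib, Summits.SmoothPoincare4.Statement, Literature.Topology.FourManifolds.Morse), including
the four glue proofs E→G→T→SmoothPoincare4, E→G→B, B→S2→E, G→T→R.
Lean: `ThinEmbeddingExists ∧ ThinSpheresBoundTwoHandlebodies ∧ PresentationSpheresStandard` (the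
item EntropyLadderThesis carries the three terms spelled out)

## Assembly
Pure logic: given M with e : M ≃ₕ 𝕊⁴, E gives a Gaussian-thin embedding ι, G turns it into a
contractible 2-handlebody W with ∂W = M, T gives M ≅ 𝕊⁴; `SmoothPoincare4` unfolds
(Literature.SPC4.SmoothPoincareConjectureFour, HomotopyEquiv.NonemptyDiffeomorphSphere) to exactly
this bare quantifier shape, so no compactness/orientability packaging is needed. Proof recipe
(checked, 4 lines): intro hE hG hT M _ _ _ cs im e; obtain ⟨ι, hι, hlt⟩ := hE M e; exact hT M e (hG
M e ι hι hlt).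

Rationale: WHY THIS LINE. Entropy is the one functional on embeddings Σ⁴ ↪ ℝ⁵ that is scale-invariant, monotone
under mean curvature flow [Huisken1990] and whose low values now CLASSIFY topology:
[ChodoshMantoulidisSchulze2025] (Thm 1.3, Cor 1.5/1.19/1.22/1.23, n = 4 unconditional) makes "λ ≤
4/e ⇒ Σ ≅ S⁴" a theorem, closing the whole absorbed card entropy-gap-r5. The thresholds λ(S⁴) <
λ(S³) < λ(S²) < λ(S¹) filter SPC4 by the maximal handle index of a bounding 5-dimensional handlebody
(an S^k×ℝ^(4−k) singularity is a (4−k)-handle of the spacetime null-cobordism, and only λ(S^k) <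
λ(Σ) can occur), and the next rung λ < λ(S¹×ℝ³) lands exactly on presentation spheres ∂H⁵(P,ε) =
boundaries of contractible 5-dimensional 2-handlebodies — joining the GMT programme
[BernsteinWang2016, BernsteinWang2018, ColdingMinicozzi2012, ColdingMinicozzi2015,
ChoiHaslhoferHershkovitsWhite2022, DanielsHolgate2022] to Andrews–Curtis / 5-dimensional handle
theory [AndrewsCurtis1965, AkbulutKirby1985, Gompf1991Killing]. Imported areas: parabolic PDE /
geometric measure theory (generic MCF) for G; combinatorial group theory and 5-dimensional handle
calculus for T; no physical analogy, no probabilistic model. NEW GROUNDING (planner read of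
[SunWangXue2025] = arXiv:2501.16678, Thm 1.1, Cor 1.3/1.6, Conj 1.4): the handle-description theorem
that G needs IS PROVED at NONDEGENERATE cylindrical singularities (topology change = (n−k)-surgery;
a Morse function on the spacetime track with one index-(n−k+1) critical point per C_(n,k) singular
point, indices ≥ 2); hence G = [CMS generic low-entropy flow in ℝ⁵: theorem] + [generic
NONDEGENERACY of the cylindrical singularities = SWX Conjecture 1.4 restricted to λ < λ(S¹) in ℝ⁵:
OPEN, locally generic by SunXue2022 = arXiv:2210.00419] + bookkeeping (λ < λ(S¹×ℝ³) forbids C_(4,3)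
singularities = 3-handles; a 5-dimensional 2-handlebody with homotopy-sphere boundary is
contractible by Lefschetz duality and codimension-≥3 handles). PLANNER CORRECTION of the card's
existence half: if Σ = ∂W with W a contractible 5-dimensional 2-handlebody then W ⊂ ℝ⁵ (W × I ≅ B⁶)
and re-embedding W as a δ-thin handlebody with cone-flared junctions and separated scales gives
λ(∂W) ≤ λ(S²×ℝ²)(1 + O(ε)) < λ(S¹×ℝ³); so the inf-entropy of an exotic presentation sphere is
exactly 4/e, NOT attained and NOT carried by a self-shrinker: the card's min–max/shrinker mechanism
is void, E ⟺ B := "every Σ bounds a contractible 2-handlebody" (support items S2 and B make both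
directions formal), and — recorded, not filed — SPC4 ⟺ "entropy attains its infimum over the
embeddings of every Σ", with inf-entropy spectrum of homotopy 4-spheres ⊆ {λ(S⁴)} ∪ {λ(S²)} ∪
{λ(S¹)} (every Σ bounds a contractible 3-handlebody: Θ₄ = 0 plus handle trading). What prior routes
do not do: NoOneHandles / GroupTrisection decompose Σ itself by 4-dimensional handles; here the
handles are 5-dimensional, produced analytically, and the residual family (presentation spheres) is
where 5-dimensional cancellation (circles unknot in 4-manifolds) is strongest. Negatives index:
empty.

RANKED CRUXES. #0 EntropyLadderThesis (target) — X = E ∧ G ∧ T as in § Thesis, the three terms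
spelled out (E: a Gaussian-thin embedding exists; G: Gaussian-thin embedded homotopy 4-spheres bound
contractible 5-dimensional 2-handlebodies; T: such boundaries are S⁴). (why it might fail: X ⟺ SPC4
(E, G, T are each consequences of SPC4: the round S⁴ has λ = 1.4436 < 1.5203 and bounds B⁵), so X
fails iff an exotic 4-sphere exists; live candidates (Gluck twists of non-ribbon 2-knots) are
neither standardised nor shown to be presentation spheres.) [ChodoshMantoulidisSchulze2025,
SunWangXue2025, AndrewsCurtis1965, Gompf1991Killing, FreedmanGompfMorrisonWalker2010]
#2 PresentationSpheresStandard (crux) — T (card item R3-TOP): a homotopy 4-sphere M that bounds a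
compact contractible smooth 5-manifold W admitting a Morse function adapted to ∂W all of whose
critical points have index ≤ 2 (`IsHandlebodyOfIndexLE 4 2 W` unfolded; W = H⁵(P,ε) for a balanced
presentation P of the trivial group after 0/1-cancellation) is diffeomorphic to S⁴. Equivalent
forms: every compact contractible 5-dimensional 2-handlebody is B⁵ (∂W ≅ S⁴ ⇒ W ∪ B⁵ ≅ S⁵ ⇒ W ≅ B⁵);
∂H⁵(P,ε) ≅ S⁴ for all (P,ε); doubles D(Δ) = ∂(Δ×I) of contractible 4-dimensional 2-handlebodies are
S⁴ (shared with card doubles-reflection-rung). Known: P Andrews–Curtis trivial ⇒ H⁵(P,ε) ≅ B⁵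
[AndrewsCurtis1965]; the Akbulut–Kirby/GST family ⟨x,y | xyx=yxy, xⁿ⁺¹=yⁿ⟩ ⇒ standard
[Gompf1991Killing]. [difficulty: open-problem] (why it might fail: It is the 5-dimensional
Andrews–Curtis problem (Kirby 5.2 remarks): an AC-nontrivial balanced presentation of the trivial
group whose thickening H⁵(P,ε) is not B⁵ would be an exotic presentation 4-sphere; only AC-trivial P
and special families (Akbulut–Kirby, Gompf 1991) are settled.) [AndrewsCurtis1965, Gompf1991Killing,
AkbulutKirby1985, GompfScharlemannThompson2010, Kirby1997]
#3 ThinSpheresBoundTwoHandlebodies (crux) — G (card item R3-GEO, regrounded): if a homotopy 4-sphere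
M is smoothly embedded in ℝ⁵ by ι with ent(range ι) < ent(S¹(√2)×ℝ³) (Colding–Minicozzi entropy
below λ(S¹×ℝ³) ≈ 1.5203) then M bounds a compact contractible smooth 5-manifold with an adapted
Morse function of index ≤ 2. Mechanism: perturb ι(M) to a generic C^∞-close M' (diffeomorphic to M)
whose flow has only multiplicity-one spherical/cylindrical singularities
[ChodoshMantoulidisSchulze2025 Thm 1.3 = Cor 1.19, Cor 1.23; λ ≤ 2 suffices in ℝ⁵]; Huisken
monotonicity + λ(M') < λ(S¹×ℝ³) exclude C_(4,3) = S¹×ℝ³ tangent flows [Huisken1990, Stone1994]; IF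
all cylindrical singularities are nondegenerate ([SunWangXue2025] Conj 1.4 — the open input; locally
generic by [SunXue2022]) then by [SunWangXue2025] Thm 1.1 + Cor 1.3/1.6 the spacetime track W is a
compact 5-manifold with ∂W = M' carrying a Morse function with one critical point of index n−k+1 ∈
{5,4,3} per S⁴ / S³×ℝ / S²×ℝ² singular point; reversed (f = 1 − t/T) these are indices 0,1,2, and a
5-dimensional 2-handlebody whose boundary is a homotopy sphere is contractible (π₁ = 1 and acyclic
by Lefschetz duality). [difficulty: XL] (why it might fail: As a statement it fails only with SPC4
(an embedded standard S⁴ bounds B⁵). As a mechanism it needs generic NONDEGENERACY of all S³×ℝ and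
S²×ℝ² singularities along the flow (Sun–Wang–Xue Conj 1.4, open; only local genericity is known) — a
robustly degenerate S²×ℝ² singularity in ℝ⁵ would void it.) [ChodoshMantoulidisSchulze2025,
SunWangXue2025, SunXue2022, ColdingMinicozzi2012, ColdingMinicozzi2015, Huisken1990, Stone1994,
ChoiHaslhoferHershkovitsWhite2022, DanielsHolgate2022]
#4 ThinEmbeddingExists (crux) — E (card item EXIST, corrected): every homotopy 4-sphere M admits a
smooth embedding ι : M → ℝ⁵ with ent(range ι) < ent(S¹(√2)×ℝ³). By the support items, E ⟺ B (every Σ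
bounds a contractible 5-dimensional 2-handlebody): B → E is the thin-handlebody construction
ThinHandlebodyEmbedding, E → B is G. Inf-entropy picture (planner): inf over embeddings is λ(S⁴) for
the standard sphere (attained), exactly λ(S²×ℝ²) = 4/e for an exotic presentation sphere (not
attained, by CMS Cor 1.5(b)), and λ(S¹×ℝ³) otherwise — so no min–max over embeddings can produce the
thin embedding; an analytic proof of E would have to come from a flow or a direct construction from
a contractible 3-handlebody bounding Σ (exists by Θ₄ = 0 + trading) that removes the 3-handles.
[difficulty: open-problem] (why it might fail: Consequence of SPC4 and (via the support glue)
equivalent to 'every homotopy 4-sphere bounds a contractible 5-dim 2-handlebody': an exotic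
non-presentation sphere kills it; removing 3-handles from a contractible W⁵ bounding Σ is the
Whitney-trick step that fails (h-cobordism barrier).) [ChodoshMantoulidisSchulze2025,
ColdingIlmanenMinicozziWhite2013, BernsteinWang2018, KervaireMilnorAnnals1963,
DonaldsonIrrationality1987]
#9 BoundsContractibleTwoHandlebody (support) — B (topological shadow of E ∧ G; interface shared with
card doubles-reflection-rung): every homotopy 4-sphere bounds a compact contractible smooth
5-manifold with an adapted Morse function of index ≤ 2 (is a presentation sphere). Glue, both
provable now by composition: ThinEmbeddingExists → ThinSpheresBoundTwoHandlebodies →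
BoundsContractibleTwoHandlebody, and BoundsContractibleTwoHandlebody → ThinHandlebodyEmbedding →
ThinEmbeddingExists (checked in Sketch.lean). Refuter-facing: ¬B ⇒ ¬SPC4 with a certificate.
[difficulty: open-problem] [AndrewsCurtis1965, Gompf1991Killing, KervaireMilnorAnnals1963]
#9 ThinHandlebodyEmbedding (support) — S2 (planner's thin-handlebody lemma, B → E pointwise): if M
bounds a compact contractible smooth 5-manifold W with an adapted Morse function of index ≤ 2, then
M has a smooth embedding into ℝ⁵ with ent(range) < ent(S¹(√2)×ℝ³). Proof sketch: W ⊂ S⁵ smoothly (W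
× I is a contractible 6-manifold with simply connected boundary, hence B⁶ by the h-cobordism
theorem; or double W), so W ⊂ ℝ⁵; W is a regular neighbourhood of its 2-dimensional spine; re-embed
as a δ-thin handlebody: 0-handle at scale 1, 1-handle tubes S³_δ₁ × I, 2-handle sheets D² × S²_δ₂
with δ₂ ≪ δ₁ ≪ 1, all junctions flared by cones of half-angle ε; local Gaussian-density models are
S⁴ caps, S³×ℝ (λ₃ = 1.4531), S²×ℝ² (λ₂ = 1.4715), hyperplane-plus-narrow-cone junctions (1 + O(ε²))
and mid-cone windows (λ_k(1 + O(ε))), so λ(∂W_δ) ≤ λ(S²×ℝ²)(1 + O(ε)) + o_δ(1) < λ(S¹×ℝ³) = 1.5203;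
finally ∂W_δ ≅ ∂W ≅ M (uniqueness of regular neighbourhoods / collars). A GMT construction, provable
in principle; also shows inf-entropy(presentation sphere) ≤ 4/e. [difficulty: L] [Stone1994,
ColdingMinicozzi2012, BernsteinWang2018, ChodoshMantoulidisSchulze2025]
#9 ThinSpheresStandard (support) — R, the RUNG THEOREM (= G ∧ T; the route's first publishable
milestone): a hypersurface of ℝ⁵ homotopy equivalent to S⁴ with Colding–Minicozzi entropy < λ(S¹×ℝ³)
≈ 1.5203 is diffeomorphic to S⁴ — extending [ChodoshMantoulidisSchulze2025] Cor 1.5(b) (threshold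
λ(S²×ℝ²) ≈ 1.4715, with isotopy) by one rung (diffeomorphism only). Glue provable now:
ThinSpheresBoundTwoHandlebodies → PresentationSpheresStandard → ThinSpheresStandard (checked in
Sketch.lean). [difficulty: open-problem] [ChodoshMantoulidisSchulze2025, BernsteinWang2018,
SunWangXue2025]

TWO-LAYER PLAN. Foreseen glued splits (filed only after a crux closes; k ≤ 3, depth 1): G ⇐ G1 → G2
→ G with G1 = "generic nondegeneracy below λ(S¹) in ℝ⁵" (every closed M⁴ ⊂ ℝ⁵ with λ < λ(S¹×ℝ³) has
arbitrarily small C^∞ graphs whose level-set flow has only nondegenerate cylindrical or spherical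
singularities: [SunWangXue2025] Conj 1.4 ∩ [ChodoshMantoulidisSchulze2025] Cor 1.23) and G2 = "SWX
track bookkeeping: such a flow from an embedded homotopy 4-sphere yields Bounds₂" ([SunWangXue2025]
Cor 1.3/1.6 + Lefschetz duality); T ⇐ T1 → T2 → T with T1 = "H⁵(P,ε) ≅ B⁵ for Andrews–Curtis-trivial
P" (provable from the tree's Handles / BalancedPresentation / IsAndrewsCurtisEquivalent library once
D2 lands) and T2 = "every contractible 5-dimensional 2-handlebody is H⁵(P,ε) with P AC-trivial OR is
standard by a Gompf-type 5-dimensional cancellation"; E ⇐ B → S2 → E is already filed as support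
glue.

KILL CRITERIA. T, G, E are each consequences of SPC4 (for G: an embedded standard S⁴ bounds B⁵), so
a formal refutation of any one is ¬SPC4 with a certificate (an exotic presentation sphere; a
Gaussian-thin exotic sphere) and closes the route together with the problem (`close --reason
refuted:<Decl>`). Soft kills / pivots: (i) [SunWangXue2025] Conjecture 1.4 shown to fail robustly
below λ(S¹) in ℝ⁵ (degenerate S²×ℝ² singularities stable under perturbation of the initial
hypersurface) — G loses its mechanism → route dormant unless a degenerate-singularity surgery
description replaces it; (ii) ThinHandlebodyEmbedding refuted (a thin 2-handle junction costs ≥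
λ(S¹) − λ(S²) ≈ 0.049 in every embedding) — the existence half loses its reduction to B → re-plan E;
(iii) a refuter shows the unnormalised μH[4]-entropy comparison in the signatures is degenerate
(e.g. both sides = ⊤) → restate G, E, S2, R through the requested definition D1 (1:1 restate, same
decl names). Mooted if: route NoOneHandles or a doubles route proves T-equivalent statements first
(then T closes by citation and the route reduces to G ∧ E).

NOT DECOMPOSED YET. Deliberately not filed at open: the G1/G2 and T1/T2 splits above (layer 2, after
a crux closes); any Literature MCF notion (level-set flow, Brakke flow, tangent flow, nondegenerate
singularity) — G is typed purely by its input (entropy of the image) and output (Bounds₂), so the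
flow lives inside the proof; the card's SHRINKER rigidity item (withdrawn: by the thin-handlebody
remark the entropy infimum of an exotic presentation sphere is 4/e and is approached by collapse
onto a 2-complex, never by a shrinker); the inf-entropy quantisation "spectrum ⊆ {λ(S⁴), λ(S²),
λ(S¹)}" and "SPC4 ⟺ attainment of inf-entropy" (pretty, but a restatement, not a crux); the negative
twins ¬T / ¬B (file with a rank only if a refuter produces a candidate presentation).

CHEAPEST FALSIFIER. For the mechanism of G: check whether Angenent–Velázquez-type DEGENERATE
neckpinches/bubble-sheet pinches can be made stable under C^∞-small perturbations of a closed M⁴ ⊂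
ℝ⁵ with λ < 1.5203 (a literature lookup in [SunXue2022] §1 and [SunWangXue2025] Remark 1.2 / Conj
1.4 discussion: they assert degenerate ones "can be perturbed away" locally) — a robust degenerate
example kills G's mechanism. For S2: a one-page Gaussian-density computation of the model
"hyperplane ℝ³ ⊂ ℝ⁴ with a half-cylinder S²(√(4t))×[0,∞) attached through a cone of half-angle ε" —
if its entropy cannot be pushed below λ(S¹) = 1.5203 as ε → 0 (planner's estimate: λ(S²)(1 + O(ε))),
S2 and the inf-entropy picture die. For T: run the tree's/GAP Andrews–Curtis search on the smallest
presentations not known AC-trivial (Miller–Schupp / GST L_(3,1)) and check against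
[Gompf1991Killing] whether their H⁵ is already known to be B⁵ — a presentation with H⁵(P) provably
exotic would refute T and SPC4 at once (none expected). Planner ran: `lean check` of all signatures
(rc 0) and the four glue proofs; no kit job (hub is compute-free for this unit).

NUMBERS. Entropy values [Stone1994; ColdingMinicozzi2012]: λ(Sⁿ) = Gaussian area of Sⁿ(√(2n)); λ(S¹)
= √(2π/e) = 1.5203, λ(S²) = 4/e = 1.4715, λ(S³) = 1.4531, λ(S⁴) = 1.4436, λ(S^k×ℝ^(4−k)) = λ(S^k); λ
decreasing in k with limit √2 = 1.4142. Thresholds: CMS Thm 1.3 needs λ ≤ 2 in ℝ⁵; Cor 1.5(a) λ ≤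
1.4531, (b) λ ≤ 1.4715 (theorems); this route: λ < 1.5203. Margin available to the thin-handlebody
junctions in S2: λ(S¹) − λ(S²) = 0.0488. Index bookkeeping [SunWangXue2025 Cor 1.3]: C_(4,k) =
S^(4−k)×ℝ^k singular point ↦ critical point of the time function of index 5 − k ↦ handle of index k
of the reversed adapted Morse function: S⁴ ↦ 0, S³×ℝ ↦ 1, S²×ℝ² ↦ 2, S¹×ℝ³ ↦ 3 (forbidden below
λ(S¹)).

DEFINITION REQUESTS. D1 `ColdingMinicozziEntropy` (topic Literature/Geometry/Riemannian, new file
e.g. GaussianEntropy.lean): Gaussian area F_(p,t)(A) = (4πt)^(−n/2) ∫_A e^(−|x−p|²/4t) dHⁿ and λ(A)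
= sup_(p,t) F for subsets/rectifiable n-varifolds of EuclideanSpace ℝ (Fin (n+1)), with the API:
invariance under isometries and dilations, λ(hyperplane) = 1, Stone's values for spheres and
cylinders, Huisken monotonicity ⇒ λ non-increasing along a smooth MCF — wanted to restate ent(·)
readably in G, E, S2, R (for ThinSpheresBoundTwoHandlebodies). D2 `PresentationHandlebodyFive`
(topic Literature/Topology/FourManifolds): the 5-dimensional handlebody H⁵(P,ε) of a
`Literature.Topology.FourManifolds.BalancedPresentation` with framings ε : Fin r → ZMod 2, with
∂H⁵(P,ε) as a closed smooth 4-manifold and the facts "AC-moves on P are realised by handle moves of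
H⁵" [AndrewsCurtis1965] — wanted for PresentationSpheresStandard (T1 split) and shared with card
doubles-reflection-rung. Cite facts wanted (filed as `--kind cite`): [ChodoshMantoulidisSchulze2025]
Thm 1.3/Cor 1.19/1.22/1.23 (n = 4); [SunWangXue2025] Thm 1.1 + Cor 1.3/1.6; [AndrewsCurtis1965] +
[Gompf1991Killing] on H⁵(P).

Novelty: Searches (2026-08-15, planner planner-plancard-SmoothPoincare4-SmoothPoinca-f01f9bbc-0): `lit
frontier SmoothPoincare4 --since 2022` (30 newest descendants of the SPC4 roots: none is an
MCF/entropy paper), `lit bridges SmoothPoincare4 --cross any`, `lit search --hybrid "nondegenerate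
cylindrical singularity mean curvature flow isolated"` (local holdings: books only, no hit),
crossref "generic mean curvature flow cylindrical singularities nondegenerate" / "Passing through
nondegenerate singularities mean curvature flow" / "Mean curvature flow with generic initial data",
zbMATH (review of arXiv:2501.16678), `lit galaxy search "mean convex neighborhood" --star pdf` (4
hits, none topological); READ: [ChodoshMantoulidisSchulze2025] = arXiv:2309.03856 pp.3, 6 (Thm 1.3,
Cor 1.5, 1.19, 1.22, 1.23 and the "serious obstacles" paragraph); [SunWangXue2025] =
arXiv:2501.16678 pp.3–7 (Thm 1.1, Cor 1.3, Conj 1.4, Cor 1.5–1.7); the card's refuter audit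
(refuter-novelty-audit-14) prior-art list adopted: arXiv:2102.11978, arXiv:1511.00387,
arXiv:2003.13858, arXiv:1205.2043, AndrewsCurtis1965, AkbulutKirby1985.
Nearest prior art found: (1) [ChodoshMantoulidisSchulze2025] Cor 1.5/1.22 (n = 4): λ ≤ λ(S³×ℝ) ⇒
isotopic to round S⁴; λ ≤ λ(S²×ℝ²) ⇒ isotopic to S⁴ or ∂(♮k S¹×B⁴) — rungs 1–2 are theorems; p.3:
"serious obstacles remain to extend the isotopy construction to λ ≤ 2". (2) [SunWangXue2025] Cor 1.6
+ Conjecture 1.4: under generic nondegeneracy the spacetime track of any closed hypersurface i  [refs: 2501.16678, 2309.03856, 2102.11978, 1511.00387, 2003.13858, 1205.2043, ChodoshMantoulidisSchulze2025, SunWangXue2025, AndrewsCurtis1965, AkbulutKirby1985, BernsteinWang2018, ColdingIlmanenMinicozziWhite2013]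

Barriers (technique_class: MCF entropy ladder, R5; 5-dim Andrews-Curtis handlebodies): - technique_class: MCF entropy ladder, R5; 5-dim Andrews-Curtis handlebodies
- Literature.Barriers.SmoothPoincare4.PropertyTwoRBarrier: does NOT apply to T — T asserts no
handle-slide or Andrews–Curtis statement about presentations; it is a statement about 5-dimensional
thickenings, for which AC-triviality is sufficient [AndrewsCurtis1965] but not necessary: the
Akbulut–Kirby/GST presentations ⟨x,y | xyx = yxy, xⁿ⁺¹ = yⁿ⟩ that carry the barrier (open hypothesis
AKPresentationsACNontrivial) have H⁵(P) ≅ B⁵ [Gompf1991Killing]; they are test cases for T, not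
counterexamples. No item of this route mentions GeneralizedPropertyR / PropertyTwoR.
- Literature.Barriers.SmoothPoincare4.StrictPropertyTwoRBarrier: same as PropertyTwoRBarrier (the
strict-slide form); not applicable for the same reason.
- Literature.Barriers.SmoothPoincare4.HCobordismBarrierFour: APPLIES IN SPIRIT to the existence half
E (⟺ B by the support items): every Σ bounds a contractible W⁵ (Θ₄ = 0), its 4- and 5-handles trade
away, and removing the remaining 3-handles is a 2/3-handle cancellation across a 4-dimensional level
— the Whitney-trick step that fails smoothly (HCobordismPrincipleFour is false). The route does NOT
evade this for E: no mechanism is claimed, E is ranked last and flagged SPC4-hard; the bet is that G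
∧ T is worth having without E. It DOES fall outside the class for G and T: G produces the
3-handle-free null-cobordism ANALYTICALLY (entropy < λ(S¹×ℝ³) forbids S¹×ℝ³ singularities =
3-handles; no

History (route lifecycle, newest last):
- 2026-08-23T04:10:37Z · DORMANT — reconciler: no traction for 5.9 d (last activity item-evidence-added at 2026-08-17T06:15:11Z); parked, not closed — `ledger route dormant route-SmoothPoincare4- (operator:999:660197)

sub-problem: SmoothPoincare4 · status: dormant · opened planner-plancard-SmoothPoincare4-SmoothPoinca-f01f9bbc-0 2026-08-15T11:23:24Z · rev 1 · ledger route-SmoothPoincare4-EntropyLadder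
GENERATED by the gate from the ledger (D-0016/17). Provers cite these decls: `theorem foo : Summit.SmoothPoincare4.SmoothPoincare4.Theses.EntropyLadder.<Decl> := …` in Summits/SmoothPoincare4/SmoothPoincare4/Theorems/<Name>.lean.
-/

namespace Summit.SmoothPoincare4.SmoothPoincare4.Theses.EntropyLadder

open scoped BigOperators Topology Manifold Classical MeasureTheory ProbabilityTheory Matrix InnerProductSpace ComplexConjugate ContinuousMap ContDiff
open Filter Set Function TopologicalSpace MeasureTheory

attribute [summit_statement] _root_.SmoothPoincare4

open Literature.SPC4

/-- item stmt-SmoothPoincare4-3716 · target · rank 0 · open · by planner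
why it might fail: X ⟺ SPC4 (E, G, T are each consequences of SPC4: the round S⁴ has λ = 1.4436 < 1.5203 and bounds B⁵), so X fails iff an exotic 4-sphere exists; live candidates (Gluck twists of non-ribbon 2-knots) are neither standardised nor shown to be presentation spheres.
sources: ChodoshMantoulidisSchulze2025, SunWangXue2025, AndrewsCurtis1965, Gompf1991Killing, FreedmanGompfMorrisonWalker2010
[target] X = E ∧ G ∧ T as in § Thesis, the three terms spelled out (E: a Gaussian-thin embedding
exists; G: Gaussian-thin embedded homotopy 4-spheres bound contractible 5-dimensional
2-handlebodies; T: such boundaries are S⁴). -/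
@[route_item "route-SmoothPoincare4-EntropyLadder"]
def EntropyLadderThesis : Prop :=
  (∀ (M : Type) [TopologicalSpace M] [T2Space M] [SecondCountableTopology M] [ChartedSpace (EuclideanSpace ℝ (Fin 4)) M] [IsManifold (𝓡 4) ∞ M], M ≃ₕ Metric.sphere (0 : EuclideanSpace ℝ (Fin 5)) 1 → ∃ ι : M → EuclideanSpace ℝ (Fin 5), Manifold.IsSmoothEmbedding (𝓡 4) (𝓡 5) ∞ ι ∧ (⨆ (p : EuclideanSpace ℝ (Fin 5)) (t : ℝ) (_ : 0 < t), (ENNReal.ofReal (t ^ 2))⁻¹ * ∫⁻ x in Set.range ι, ENNReal.ofReal (Real.exp (-(‖x - p‖ ^ 2) / (4 * t))) ∂μH[4]) < (⨆ (p : EuclideanSpace ℝ (Fin 5)) (t : ℝ) (_ : 0 < t), (ENNReal.ofReal (t ^ 2))⁻¹ * ∫⁻ x in {y : EuclideanSpace ℝ (Fin 5) | y 0 ^ 2 + y 1 ^ 2 = 2}, ENNReal.ofReal (Real.exp (-(‖x - p‖ ^ 2) / (4 * t))) ∂μH[4])) ∧ (∀ (M : Type) [TopologicalSpace M] [T2Space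 M] [SecondCountableTopology M] [ChartedSpace (EuclideanSpace ℝ (Fin 4)) M] [IsManifold (𝓡 4) ∞ M], M ≃ₕ Metric.sphere (0 : EuclideanSpace ℝ (Fin 5)) 1 → ∀ ι : M → EuclideanSpace ℝ (Fin 5), Manifold.IsSmoothEmbedding (𝓡 4) (𝓡 5) ∞ ι → (⨆ (p : EuclideanSpace ℝ (Fin 5)) (t : ℝ) (_ : 0 < t), (ENNReal.ofReal (t ^ 2))⁻¹ * ∫⁻ x in Set.range ι, ENNReal.ofReal (Real.exp (-(‖x - p‖ ^ 2) / (4 * t))) ∂μH[4]) < (⨆ (p : EuclideanSpace ℝ (Fin 5)) (t : ℝ) (_ : 0 < t), (ENNReal.ofReal (t ^ 2))⁻¹ * ∫⁻ x in {y : EuclideanSpace ℝ (Fin 5) | y 0 ^ 2 + y 1 ^ 2 = 2}, ENNReal.ofReal (Real.exp (-(‖x - p‖ ^ 2) / (4 * t))) ∂μH[4]) → ∃ (W : Type) (_ : TopologicalSpace W) (_ : T2Space W) (_ : SecondCountableTopology W) (_ : ChartedSpace (EuclideanHalfSpace (4 + 1)) W) (_ : IsManifold (𝓡∂ (4 + 1))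 ∞ W) (_ : CompactSpace W), ContractibleSpace W ∧ (∃ f : W → ℝ, Literature.Topology.FourManifolds.IsMorseAdapted (𝓡∂ (4 + 1)) f ∧ ∀ z, Literature.Topology.FourManifolds.IsMCriticalPt (𝓡∂ (4 + 1)) f z → Literature.Topology.FourManifolds.morseIndex (𝓡∂ (4 + 1)) f z ≤ 2) ∧ ∃ φ : M → W, Manifold.IsSmoothEmbedding (𝓡 4) (𝓡∂ (4 + 1)) ∞ φ ∧ Set.range φ = (𝓡∂ (4 + 1)).boundary W) ∧ (∀ (M : Type) [TopologicalSpace M] [T2Space M] [SecondCountableTopology M] [ChartedSpace (EuclideanSpace ℝ (Fin 4)) M] [IsManifold (𝓡 4) ∞ M], M ≃ₕ Metric.sphere (0 : EuclideanSpace ℝ (Fin 5)) 1 → (∃ (W : Type) (_ : TopologicalSpace W) (_ : T2Space W) (_ : SecondCountableTopology W) (_ : ChartedSpace (EuclideanHalfSpace (4 + 1)) W) (_ : IsManifold (𝓡∂ (4 + 1)) ∞ W) (_ : CompactSpace W), ContractibleSpace W ∧ (∃ f : W → ℝ, Literature.Topology.FourManifolds.IsMorseAdapted (𝓡∂ (4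 + 1)) f ∧ ∀ z, Literature.Topology.FourManifolds.IsMCriticalPt (𝓡∂ (4 + 1)) f z → Literature.Topology.FourManifolds.morseIndex (𝓡∂ (4 + 1)) f z ≤ 2) ∧ ∃ φ : M → W, Manifold.IsSmoothEmbedding (𝓡 4) (𝓡∂ (4 + 1)) ∞ φ ∧ Set.range φ = (𝓡∂ (4 + 1)).boundary W) → Nonempty (M ≃ₘ⟮𝓡 4, 𝓡 4⟯ Metric.sphere (0 : EuclideanSpace ℝ (Fin 5)) 1))

/-- item stmt-SmoothPoincare4-3717 · crux · rank 2 · open · by planner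
why it might fail: It is the 5-dimensional Andrews–Curtis problem (Kirby 5.2 remarks): an AC-nontrivial balanced presentation of the trivial group whose thickening H⁵(P,ε) is not B⁵ would be an exotic presentation 4-sphere; only AC-trivial P and special families (Akbulut–Kirby, Gompf 1991) are settled.
sources: AndrewsCurtis1965, Gompf1991Killing, AkbulutKirby1985, GompfScharlemannThompson2010, Kirby1997
[crux] T (card item R3-TOP): a homotopy 4-sphere M that bounds a compact contractible smooth
5-manifold W admitting a Morse function adapted to ∂W all of whose critical points have index ≤ 2
(`IsHandlebodyOfIndexLE 4 2 W` unfolded; W = H⁵(P,ε) for a balanced presentation P of the trivial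
group after 0/1-cancellation) is diffeomorphic to S⁴. Equivalent forms: every compact contractible
5-dimensional 2-handlebody is B⁵ (∂W ≅ S⁴ ⇒ W ∪ B⁵ ≅ S⁵ ⇒ W ≅ B⁵); ∂H⁵(P,ε) ≅ S⁴ for all (P,ε);
doubles D(Δ) = ∂(Δ×I) of contractible 4-dimensional 2-handlebodies are S⁴ (shared with card
doubles-reflection-rung). Known: P Andrews–Curtis trivial ⇒ H⁵(P,ε) ≅ B⁵ [AndrewsCurtis1965]; the
Akbulut–Kirby/GST family ⟨x,y | xyx=yxy, xⁿ⁺¹=yⁿ⟩ ⇒ standard [Gompf1991Killing]. [difficulty: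
open-problem] -/
@[route_item "route-SmoothPoincare4-EntropyLadder", crux]
def PresentationSpheresStandard : Prop :=
  ∀ (M : Type) [TopologicalSpace M] [T2Space M] [SecondCountableTopology M] [ChartedSpace (EuclideanSpace ℝ (Fin 4)) M] [IsManifold (𝓡 4) ∞ M], M ≃ₕ Metric.sphere (0 : EuclideanSpace ℝ (Fin 5)) 1 → (∃ (W : Type) (_ : TopologicalSpace W) (_ : T2Space W) (_ : SecondCountableTopology W) (_ : ChartedSpace (EuclideanHalfSpace (4 + 1)) W) (_ : IsManifold (𝓡∂ (4 + 1)) ∞ W) (_ : CompactSpace W), ContractibleSpace W ∧ (∃ f : W → ℝ, Literature.Topology.FourManifolds.IsMorseAdapted (𝓡∂ (4 + 1)) f ∧ ∀ z, Literature.Topology.FourManifolds.IsMCriticalPt (𝓡∂ (4 + 1)) f z → Literature.Topology.FourManifolds.morseIndex (𝓡∂ (4 + 1)) f z ≤ 2) ∧ ∃ φ : M → W, Manifold.IsSmoothEmbedding (𝓡 4) (𝓡∂ (4 + 1)) ∞ φ ∧ Set.range φ = (𝓡∂ (4 + 1)).boundary W) → Nonempty (M ≃ₘ⟮𝓡 4,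 𝓡 4⟯ Metric.sphere (0 : EuclideanSpace ℝ (Fin 5)) 1)

/-- item stmt-SmoothPoincare4-3718 · crux · rank 3 · open · by planner
why it might fail: As a statement it fails only with SPC4 (an embedded standard S⁴ bounds B⁵). As a mechanism it needs generic NONDEGENERACY of all S³×ℝ and S²×ℝ² singularities along the flow (Sun–Wang–Xue Conj 1.4, open; only local genericity is known) — a robustly degenerate S²×ℝ² singularity in ℝ⁵ would void it.
sources: ChodoshMantoulidisSchulze2025, SunWangXue2025, SunXue2022, ColdingMinicozzi2012, ColdingMinicozzi2015, Huisken1990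
[crux] G (card item R3-GEO, regrounded): if a homotopy 4-sphere M is smoothly embedded in ℝ⁵ by ι
with ent(range ι) < ent(S¹(√2)×ℝ³) (Colding–Minicozzi entropy below λ(S¹×ℝ³) ≈ 1.5203) then M bounds
a compact contractible smooth 5-manifold with an adapted Morse function of index ≤ 2. Mechanism:
perturb ι(M) to a generic C^∞-close M' (diffeomorphic to M) whose flow has only multiplicity-one
spherical/cylindrical singularities [ChodoshMantoulidisSchulze2025 Thm 1.3 = Cor 1.19, Cor 1.23; λ ≤
2 suffices in ℝ⁵]; Huisken monotonicity + λ(M') < λ(S¹×ℝ³) exclude C_(4,3) = S¹×ℝ³ tangent flows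
[Huisken1990, Stone1994]; IF all cylindrical singularities are nondegenerate ([SunWangXue2025] Conj
1.4 — the open input; locally generic by [SunXue2022]) then by [SunWangXue2025] Thm 1.1 + Cor
1.3/1.6 the spacetime track W is a compact 5-manifold with ∂W = M' carrying a Morse function with
one critical point of index n−k+1 ∈ {5,4,3} per S⁴ / S³×ℝ / S²×ℝ² singular point; reversed (f = 1 −
t/T) these are indices 0,1,2, and a 5-dimensional 2-handlebody whose boundary is a homotopy sphere
is contractible (π₁ = 1 and acyclic by Lefschetz duality). [difficulty: XL] -/
@[route_item "route-SmoothPoincare4-EntropyLadder", crux]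
def ThinSpheresBoundTwoHandlebodies : Prop :=
  ∀ (M : Type) [TopologicalSpace M] [T2Space M] [SecondCountableTopology M] [ChartedSpace (EuclideanSpace ℝ (Fin 4)) M] [IsManifold (𝓡 4) ∞ M], M ≃ₕ Metric.sphere (0 : EuclideanSpace ℝ (Fin 5)) 1 → ∀ ι : M → EuclideanSpace ℝ (Fin 5), Manifold.IsSmoothEmbedding (𝓡 4) (𝓡 5) ∞ ι → (⨆ (p : EuclideanSpace ℝ (Fin 5)) (t : ℝ) (_ : 0 < t), (ENNReal.ofReal (t ^ 2))⁻¹ * ∫⁻ x in Set.range ι, ENNReal.ofReal (Real.exp (-(‖x - p‖ ^ 2) / (4 * t))) ∂μH[4]) < (⨆ (p : EuclideanSpace ℝ (Fin 5)) (t : ℝ) (_ : 0 < t), (ENNReal.ofReal (t ^ 2))⁻¹ * ∫⁻ x in {y : EuclideanSpace ℝ (Fin 5) | y 0 ^ 2 + y 1 ^ 2 = 2}, ENNReal.ofReal (Real.exp (-(‖x - p‖ ^ 2) / (4 * t))) ∂μH[4]) → ∃ (W : Type) (_ : TopologicalSpace W) (_ : T2Space W) (_ : SecondCountableTopology W) (_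 : ChartedSpace (EuclideanHalfSpace (4 + 1)) W) (_ : IsManifold (𝓡∂ (4 + 1)) ∞ W) (_ : CompactSpace W), ContractibleSpace W ∧ (∃ f : W → ℝ, Literature.Topology.FourManifolds.IsMorseAdapted (𝓡∂ (4 + 1)) f ∧ ∀ z, Literature.Topology.FourManifolds.IsMCriticalPt (𝓡∂ (4 + 1)) f z → Literature.Topology.FourManifolds.morseIndex (𝓡∂ (4 + 1)) f z ≤ 2) ∧ ∃ φ : M → W, Manifold.IsSmoothEmbedding (𝓡 4) (𝓡∂ (4 + 1)) ∞ φ ∧ Set.range φ = (𝓡∂ (4 + 1)).boundary W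

/-- item stmt-SmoothPoincare4-3719 · crux · rank 4 · open · by planner
why it might fail: Consequence of SPC4 and (via the support glue) equivalent to 'every homotopy 4-sphere bounds a contractible 5-dim 2-handlebody': an exotic non-presentation sphere kills it; removing 3-handles from a contractible W⁵ bounding Σ is the Whitney-trick step that fails (h-cobordism barrier).
sources: ChodoshMantoulidisSchulze2025, ColdingIlmanenMinicozziWhite2013, BernsteinWang2018, KervaireMilnorAnnals1963, DonaldsonIrrationality1987
[crux] E (card item EXIST, corrected): every homotopy 4-sphere M admits a smooth embedding ι : M →
ℝ⁵ with ent(range ι) < ent(S¹(√2)×ℝ³). By the support items, E ⟺ B (every Σ bounds a contractible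
5-dimensional 2-handlebody): B → E is the thin-handlebody construction ThinHandlebodyEmbedding, E →
B is G. Inf-entropy picture (planner): inf over embeddings is λ(S⁴) for the standard sphere
(attained), exactly λ(S²×ℝ²) = 4/e for an exotic presentation sphere (not attained, by CMS Cor
1.5(b)), and λ(S¹×ℝ³) otherwise — so no min–max over embeddings can produce the thin embedding; an
analytic proof of E would have to come from a flow or a direct construction from a contractible
3-handlebody bounding Σ (exists by Θ₄ = 0 + trading) that removes the 3-handles. [difficulty:
open-problem] -/
@[route_item "route-SmoothPoincare4-EntropyLadder", crux]
def ThinEmbeddingExists : Prop :=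
  ∀ (M : Type) [TopologicalSpace M] [T2Space M] [SecondCountableTopology M] [ChartedSpace (EuclideanSpace ℝ (Fin 4)) M] [IsManifold (𝓡 4) ∞ M], M ≃ₕ Metric.sphere (0 : EuclideanSpace ℝ (Fin 5)) 1 → ∃ ι : M → EuclideanSpace ℝ (Fin 5), Manifold.IsSmoothEmbedding (𝓡 4) (𝓡 5) ∞ ι ∧ (⨆ (p : EuclideanSpace ℝ (Fin 5)) (t : ℝ) (_ : 0 < t), (ENNReal.ofReal (t ^ 2))⁻¹ * ∫⁻ x in Set.range ι, ENNReal.ofReal (Real.exp (-(‖x - p‖ ^ 2) / (4 * t))) ∂μH[4]) < (⨆ (p : EuclideanSpace ℝ (Fin 5)) (t : ℝ) (_ : 0 < t), (ENNReal.ofReal (t ^ 2))⁻¹ * ∫⁻ x in {y : EuclideanSpace ℝ (Fin 5) | y 0 ^ 2 + y 1 ^ 2 = 2}, ENNReal.ofReal (Real.exp (-(‖x - p‖ ^ 2) / (4 * t))) ∂μH[4])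

/-- item stmt-SmoothPoincare4-3720 · support · rank 9 · open · by planner
sources: AndrewsCurtis1965, Gompf1991Killing, KervaireMilnorAnnals1963
[support] B (topological shadow of E ∧ G; interface shared with card doubles-reflection-rung): every
homotopy 4-sphere bounds a compact contractible smooth 5-manifold with an adapted Morse function of
index ≤ 2 (is a presentation sphere). Glue, both provable now by composition: ThinEmbeddingExists →
ThinSpheresBoundTwoHandlebodies → BoundsContractibleTwoHandlebody, and
BoundsContractibleTwoHandlebody → ThinHandlebodyEmbedding → ThinEmbeddingExists (checked in
Sketch.lean). Refuter-facing: ¬B ⇒ ¬SPC4 with a certificate. [difficulty: open-problem] -/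
@[route_item "route-SmoothPoincare4-EntropyLadder"]
def BoundsContractibleTwoHandlebody : Prop :=
  ∀ (M : Type) [TopologicalSpace M] [T2Space M] [SecondCountableTopology M] [ChartedSpace (EuclideanSpace ℝ (Fin 4)) M] [IsManifold (𝓡 4) ∞ M], M ≃ₕ Metric.sphere (0 : EuclideanSpace ℝ (Fin 5)) 1 → ∃ (W : Type) (_ : TopologicalSpace W) (_ : T2Space W) (_ : SecondCountableTopology W) (_ : ChartedSpace (EuclideanHalfSpace (4 + 1)) W) (_ : IsManifold (𝓡∂ (4 + 1)) ∞ W) (_ : CompactSpace W), ContractibleSpace W ∧ (∃ f : W → ℝ, Literature.Topology.FourManifolds.IsMorseAdapted (𝓡∂ (4 + 1)) f ∧ ∀ z, Literature.Topology.FourManifolds.IsMCriticalPt (𝓡∂ (4 + 1)) f z → Literature.Topology.FourManifolds.morseIndex (𝓡∂ (4 + 1)) f z ≤ 2) ∧ ∃ φ : M → W, Manifold.IsSmoothEmbedding (𝓡 4) (𝓡∂ (4 + 1)) ∞ φ ∧ Set.range φ = (𝓡∂ (4 + 1)).boundary W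

/-- item stmt-SmoothPoincare4-3721 · support · rank 9 · open · by planner
sources: Stone1994, ColdingMinicozzi2012, BernsteinWang2018, ChodoshMantoulidisSchulze2025
[support] S2 (planner's thin-handlebody lemma, B → E pointwise): if M bounds a compact contractible
smooth 5-manifold W with an adapted Morse function of index ≤ 2, then M has a smooth embedding into
ℝ⁵ with ent(range) < ent(S¹(√2)×ℝ³). Proof sketch: W ⊂ S⁵ smoothly (W × I is a contractible
6-manifold with simply connected boundary, hence B⁶ by the h-cobordism theorem; or double W), so W ⊂
ℝ⁵; W is a regular neighbourhood of its 2-dimensional spine; re-embed as a δ-thin handlebody: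
0-handle at scale 1, 1-handle tubes S³_δ₁ × I, 2-handle sheets D² × S²_δ₂ with δ₂ ≪ δ₁ ≪ 1, all
junctions flared by cones of half-angle ε; local Gaussian-density models are S⁴ caps, S³×ℝ (λ₃ =
1.4531), S²×ℝ² (λ₂ = 1.4715), hyperplane-plus-narrow-cone junctions (1 + O(ε²)) and mid-cone windows
(λ_k(1 + O(ε))), so λ(∂W_δ) ≤ λ(S²×ℝ²)(1 + O(ε)) + o_δ(1) < λ(S¹×ℝ³) = 1.5203; finally ∂W_δ ≅ ∂W ≅ M
(uniqueness of regular neighbourhoods / collars). A GMT construction, provable in principle; also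
shows inf-entropy(presentation sphere) ≤ 4/e. [difficulty: L] -/
@[route_item "route-SmoothPoincare4-EntropyLadder"]
def ThinHandlebodyEmbedding : Prop :=
  ∀ (M : Type) [TopologicalSpace M] [T2Space M] [SecondCountableTopology M] [ChartedSpace (EuclideanSpace ℝ (Fin 4)) M] [IsManifold (𝓡 4) ∞ M], (∃ (W : Type) (_ : TopologicalSpace W) (_ : T2Space W) (_ : SecondCountableTopology W) (_ : ChartedSpace (EuclideanHalfSpace (4 + 1)) W) (_ : IsManifold (𝓡∂ (4 + 1)) ∞ W) (_ : CompactSpace W), ContractibleSpace W ∧ (∃ f : W → ℝ, Literature.Topology.FourManifolds.IsMorseAdapted (𝓡∂ (4 + 1)) f ∧ ∀ z, Literature.Topology.FourManifolds.IsMCriticalPt (𝓡∂ (4 + 1)) f z → Literature.Topology.FourManifolds.morseIndex (𝓡∂ (4 + 1)) f z ≤ 2) ∧ ∃ φ : M → W, Manifold.IsSmoothEmbedding (𝓡 4) (𝓡∂ (4 + 1)) ∞ φ ∧ Set.range φ = (𝓡∂ (4 + 1)).boundary W) → ∃ ι : M → EuclideanSpace ℝ (Fin 5), Manifold.IsSmoothEmbedding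 (𝓡 4) (𝓡 5) ∞ ι ∧ (⨆ (p : EuclideanSpace ℝ (Fin 5)) (t : ℝ) (_ : 0 < t), (ENNReal.ofReal (t ^ 2))⁻¹ * ∫⁻ x in Set.range ι, ENNReal.ofReal (Real.exp (-(‖x - p‖ ^ 2) / (4 * t))) ∂μH[4]) < (⨆ (p : EuclideanSpace ℝ (Fin 5)) (t : ℝ) (_ : 0 < t), (ENNReal.ofReal (t ^ 2))⁻¹ * ∫⁻ x in {y : EuclideanSpace ℝ (Fin 5) | y 0 ^ 2 + y 1 ^ 2 = 2}, ENNReal.ofReal (Real.exp (-(‖x - p‖ ^ 2) / (4 * t))) ∂μH[4])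

/-- item stmt-SmoothPoincare4-3722 · support · rank 9 · open · by planner
sources: ChodoshMantoulidisSchulze2025, BernsteinWang2018, SunWangXue2025
[support] R, the RUNG THEOREM (= G ∧ T; the route's first publishable milestone): a hypersurface of
ℝ⁵ homotopy equivalent to S⁴ with Colding–Minicozzi entropy < λ(S¹×ℝ³) ≈ 1.5203 is diffeomorphic to
S⁴ — extending [ChodoshMantoulidisSchulze2025] Cor 1.5(b) (threshold λ(S²×ℝ²) ≈ 1.4715, with
isotopy) by one rung (diffeomorphism only). Glue provable now: ThinSpheresBoundTwoHandlebodies →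
PresentationSpheresStandard → ThinSpheresStandard (checked in Sketch.lean). [difficulty:
open-problem] -/
@[route_item "route-SmoothPoincare4-EntropyLadder"]
def ThinSpheresStandard : Prop :=
  ∀ (M : Type) [TopologicalSpace M] [T2Space M] [SecondCountableTopology M] [ChartedSpace (EuclideanSpace ℝ (Fin 4)) M] [IsManifold (𝓡 4) ∞ M], M ≃ₕ Metric.sphere (0 : EuclideanSpace ℝ (Fin 5)) 1 → ∀ ι : M → EuclideanSpace ℝ (Fin 5), Manifold.IsSmoothEmbedding (𝓡 4) (𝓡 5) ∞ ι → (⨆ (p : EuclideanSpace ℝ (Fin 5)) (t : ℝ) (_ : 0 < t), (ENNReal.ofReal (t ^ 2))⁻¹ * ∫⁻ x in Set.range ι, ENNReal.ofReal (Real.exp (-(‖x - p‖ ^ 2) / (4 * t))) ∂μH[4]) < (⨆ (p : EuclideanSpace ℝ (Fin 5)) (t : ℝ) (_ : 0 < t), (ENNReal.ofReal (t ^ 2))⁻¹ * ∫⁻ x in {y : EuclideanSpace ℝ (Fin 5) | y 0 ^ 2 + y 1 ^ 2 = 2}, ENNReal.ofReal (Real.exp (-(‖x - p‖ ^ 2)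 / (4 * t))) ∂μH[4]) → Nonempty (M ≃ₘ⟮𝓡 4, 𝓡 4⟯ Metric.sphere (0 : EuclideanSpace ℝ (Fin 5)) 1)

/-- item stmt-SmoothPoincare4-3723 · assembly · rank 1 · open · by planner
sources: ChodoshMantoulidisSchulze2025, SunWangXue2025, AndrewsCurtis1965
[assembly] ThinEmbeddingExists → ThinSpheresBoundTwoHandlebodies → PresentationSpheresStandard →
SmoothPoincare4 (provable now). -/
@[route_item "route-SmoothPoincare4-EntropyLadder"]
def Assembly : Prop :=
  ThinEmbeddingExists → ThinSpheresBoundTwoHandlebodies → PresentationSpheresStandard → SmoothPoincare4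

/-! D-0027 §2.1 — DECIDING THEOREM (planner-authored via `route open/edit --closes-file`; by planner-rbadge-SmoothPoincare4-EntropyLadder-468f5722-g4-0 2026-08-15T16:09:52Z):
its hypotheses are this route's items and its conclusion the sub-problem Statement (glue_lint), and it elaborates with this file. -/

@[closes "route-SmoothPoincare4-EntropyLadder"] theorem closes (hE : ThinEmbeddingExists) (hG : ThinSpheresBoundTwoHandlebodies)
    (hT : PresentationSpheresStandard) : _root_.SmoothPoincare4 := by
  unfold _root_.SmoothPoincare4 Literature.SPC4.SmoothPoincareConjectureFour
    ContinuousMap.HomotopyEquiv.NonemptyDiffeomorphSphere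
  intro M _ _ _ _ _ e
  obtain ⟨ι, hι, hlt⟩ := hE M e
  exact hT M e (hG M e ι hι hlt)

end Summit.SmoothPoincare4.SmoothPoincare4.Theses.EntropyLadder
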